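import Summits.QuantumFields.BalabanUV.Beta.EriceFlowEnclosureB12AsPrintedHistoryUnique

/-!
# Beta / EriceFlowEnclosureB12AsPrintedHistoryUniformDepth — «g₀ = g₀(ε, g)» IS A FUNCTION UP TO A DEPTH K ≍ b³∕C² under a UNIFORM
# (non-fading) history modulus: the endpoint θ = 1 of node U2's fading-memory letter (β-flow team, prover 1 = recursion ∕ upper ∕
# bare-coupling ∕ UNIQUENESS side, unit `b2b-balaban-beta-bflow-p1`, gen 34; ROW AP-I·C × ROW U; PART 1 = `…B12AsPrintedHistoryUnique`
# (#61e: K-UNIFORM uniqueness under `FadingMemory C θ Λ`, θ < 1); companion `…B12AsPrintedHistoryNonunique*` (gen 34: beyond that depth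
# uniqueness FAILS under a uniform modulus — the depth scale is sharp and fading memory is load-bearing for K-uniformity))

HONEST FRAMING (page 1 of everything the β sub-cell writes): discharging `BetaPertH` makes Bałaban's UV stability UNCONDITIONAL — a
real constructive-QFT result; it is NOT the continuum limit and NOT the Clay problem.  HONEST DEPENDENCY (cell reorg 2026-08-19,
verbatim): «continuum YM on T⁴ ⇐ BetaPertH ∧ nine spine estimates (0/9 proved); BetaPertH ⇐ (D1) ∧ (D4) ∧ CAP+tail; G-an2-4 gates
asym, D1 and NE2/3/4.»  THIS MODULE DISCHARGES NOTHING: finite-sum bookkeeping from the NAMED FIELDS of the statement-exact typing of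
[I] = T. Bałaban, Commun. Math. Phys. **109** (1987) [Balaban1987RG1] (`B12BetaAsPrinted`, p537882 ✓ ∕ v1.1 p539116 ✓) under node U2's
HYPOTHESIS SHAPES `T4CouplingMatching.HistLipschitz Λ γ β` and `FadingMemory C θ Λ` READ AT θ = 1 (i.e. `0 ≤ Λ k i ≤ C`: ONE constant for
the dependence of β_{k+1} on EVERY preceding coupling, no decay in the age k − i — the tree's uniform coordinatewise clause
`BetaDerivClause.CoordLipschitzAt`, `T4CouplingMatching.histLipschitz_of_coordLipschitz`) and the AF letter `FlowStep.BetaLowerH b` (b > 0).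
NONE of these is printed ([I] p. 298 says only that β_j *"depends also on all preceding coupling constants"*; Theorem 2 is STATED WITHOUT
PROOF, p. 259); every letter is a hypothesis on an abstract `Setting S`; nothing of Bałaban's objects is asserted.

THE POINT.  PART 1 (#61e `runs_eq_of_fadingMemory`) makes Theorem 2's *"g₀ = g₀(ε, g)"* (p. 259) a FUNCTION in the history reading under
fading-memory moduli Λ k i ≤ Cθ^{k−i}, θ < 1, with a smallness C(γ³ + 2γ∕b) ≤ (1 − θ)∕2 that DEGENERATES at θ = 1; its docstring records
that the uniform clause Λ ≡ C *"does NOT feed"* the argument.  What DOES a uniform modulus give?  The same discrepancy recursion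
δ_j ≤ δ_{j+1} + C Σ_{i≤j} (g_i² g′_i) δ_i (PART 1's `hist_step`), δ_K = 0, closes by a SUP-NORM argument whenever the DEPTH-WEIGHTED sum
W_K := Σ_{i≤K} (K − i)·g_i² g′_i has C·W_K < 1 (`feedback_kernel_zero`: the feedback of scale i is felt by the K − i steps below it);
along two AF runs (K − i)·g_i² ≤ 1∕b and g′_i ≤ a_{K−i}^{−1∕2} (a_m = 1∕γ² + bm), and Σ_{m≤K} a_m^{−1∕2} ≤ γ + (2∕b)√a_K telescopes
(`sum_invSprof_le`), so W_K ≤ (γ + (2∕b)√(1∕γ² + bK))∕b (`sum_depthWeights_le`) — it GROWS LIKE √K.  Hence (§16) **`runs_eq_of_uniformModulus`**: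
two same-length runs pinned at the same renormalized coupling coincide provided C(γ + (2∕b)√(1∕γ² + bK)) < b, i.e. UP TO A DEPTH
K < K_*(b, C, γ) ≍ b³∕(4C²); on the carrier `bareCoupling_unique_upToDepth` and the END **`theorem2_existsUnique_upToDepth`** (Theorem 2 +
`Definitions` + (U) + AF + uniform modulus ⟹ for small γ, small g and every K BELOW THE DEPTH BOUND: exactly one bare coupling).  The
companion `…HistoryNonunique*` shows the depth scale b³∕C² is SHARP: with a uniform modulus of constant C two DISTINCT bare couplings
with in-interval runs ending at the same g exist at depths K ≳ b³∕C² — so the K-UNIFORM statement of PART 1 genuinely needs θ < 1.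

WHAT THIS FILE PROVES (0 sorry, 0 def): §15 `sum_exchange_depth`, **`feedback_kernel_zero`** (the sup-norm kernel: δ ≡ 0 when C·W < 1),
`inv_sprof_le_telescope`, `sum_invSprof_le` (Σ_{m≤K} a_m^{−1∕2} ≤ γ + (2∕b)√a_K), **`sum_depthWeights_le`** (W_K ≤ (γ + (2∕b)√a_K)∕b along two AF runs),
`sum_depthWeights_le_linear` (W_K ≤ K(γ³ + 2γ∕b)); §16 **`runs_eq_of_uniformModulus`**, `runs_eq_of_uniformModulus_linear`, `bareCoupling_unique_upToDepth`,
**`theorem2_existsUnique_upToDepth`**.  NOT CLAIMED: anything about Bałaban's β; Theorem 2; `BetaPertH`; uniqueness at every depth (FALSE in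
general under these letters: companion); continuum; Clay.
-/

namespace Summit.QuantumFields.BalabanUV.Beta.EriceFlowEnclosureB12AsPrintedHistoryUniformDepth

open Finset
open Literature.MathematicalPhysics.QuantumFieldTheory.Balaban1983to89
open Literature.MathematicalPhysics.QuantumFieldTheory.Balaban1983to89.B12BetaAsPrinted
open Literature.MathematicalPhysics.QuantumFieldTheory.Balaban1983to89.FlowStep (prefixOf Box mem_box box_mono RGEqH BetaLowerH
  BetaUpperH)
open Literature.MathematicalPhysics.QuantumFieldTheory.Balaban1983to89.T4CouplingMatching (HistLipschitz FadingMemory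
  inv_sq_lower_of_betaLower prof sprof sprof_pos sprof_sq sprof_mono sprof_sq_diff sprof_zero prof_pos)
open Summit.QuantumFields.BalabanUV.Beta.EriceFlowEnclosureB12AsPrintedUpper (tunedRuns_of_theorem2Statement)
open Summit.QuantumFields.BalabanUV.Beta.EriceFlowEnclosureB12AsPrintedTunedUpper (hrg_of_betaUpperH)
open Summit.QuantumFields.BalabanUV.Beta.EriceFlowEnclosureB12AsPrintedHistoryUnique (hist_step sum_weights_le)

noncomputable section

variable {S : Setting}

/-! ## §15 The sup-norm kernel and the depth-weighted AF sum -/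

/-- **Exchange of the feedback double sum**: Σ_{m<K} Σ_{i≤m} w_i = Σ_{i<K} (K − i)·w_i (the weight of scale i is counted once by each
of the K − i steps m ∈ [i, K) below it). [folklore] -/
theorem sum_exchange_depth (w : ℕ → ℝ) (K : ℕ) :
    ∑ m ∈ range K, ∑ i ∈ range (m + 1), w i = ∑ i ∈ range K, ((K - i : ℕ) : ℝ) * w i := by
  induction K with
  | zero => simp
  | succ K ih =>
    rw [Finset.sum_range_succ, ih, Finset.sum_range_succ (fun i => ((K + 1 - i : ℕ) : ℝ) * w i),
      Finset.sum_range_succ (fun i => w i)]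
    have h1 : ∑ i ∈ range K, ((K + 1 - i : ℕ) : ℝ) * w i = ∑ i ∈ range K, ((K - i : ℕ) : ℝ) * w i + ∑ i ∈ range K, w i := by
      rw [← Finset.sum_add_distrib]
      refine Finset.sum_congr rfl fun i hi => ?_
      have hiK : i < K := mem_range.mp hi
      rw [show K + 1 - i = (K - i) + 1 by omega]
      push_cast
      ring
    rw [h1, Nat.add_sub_cancel_left]
    push_cast
    ring

/-- **THE SUP-NORM KERNEL (uniform feedback, no fading).**  δ ≥ 0 on [0, K], δ_K = 0, weights w_i ≥ 0, and for j < K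
`δ_j ≤ δ_{j+1} + C·Σ_{i≤j} w_i δ_i` (C ≥ 0).  If `C·Σ_{i<K} (K − i) w_i < 1` then δ ≡ 0 on [0, K]: with M := max_{i≤K} δ_i, backward
summation gives δ_j ≤ C·M·Σ_{m∈[j,K)} Σ_{i≤m} w_i ≤ C·M·W, so M ≤ (C·W)·M and M = 0.  (Node U2's `twoSided_fixedPoint` needs θ < 1; this is
the θ = 1 substitute, paid for by the depth weight K − i.) [folklore] -/
theorem feedback_kernel_zero {K : ℕ} {δ w : ℕ → ℝ} {C : ℝ} (hC : 0 ≤ C) (hδ : ∀ j, 0 ≤ δ j) (hw : ∀ i, i ≤ K → 0 ≤ w i)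
    (hK : δ K = 0) (hrec : ∀ j, j < K → δ j ≤ δ (j + 1) + C * ∑ i ∈ range (j + 1), w i * δ i)
    (hsmall : C * ∑ i ∈ range K, ((K - i : ℕ) : ℝ) * w i < 1) : ∀ j, j ≤ K → δ j = 0 := by
  have hne : (range (K + 1)).Nonempty := ⟨0, by simp⟩
  obtain ⟨i₀, hi₀, hMeq⟩ := Finset.exists_mem_eq_sup' hne δ
  have hi₀K : i₀ ≤ K := Nat.lt_succ_iff.mp (mem_range.mp hi₀)
  have hMi : ∀ i, i ≤ K → δ i ≤ δ i₀ := by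
    intro i hi
    have h := Finset.le_sup' δ (mem_range.mpr (Nat.lt_succ_of_le hi))
    rw [hMeq] at h
    exact h
  set M : ℝ := δ i₀ with hM
  have hM0 : 0 ≤ M := hδ i₀
  -- the feedback at step m is ≤ C·M·Σ_{i≤m} w_i
  have hfb : ∀ m, m < K → C * ∑ i ∈ range (m + 1), w i * δ i ≤ C * M * ∑ i ∈ range (m + 1), w i := by
    intro m hm
    rw [mul_assoc, Finset.mul_sum (s := range (m + 1)) (f := fun i => w i) M]
    refine mul_le_mul_of_nonneg_left (Finset.sum_le_sum fun i hi => ?_) hC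
    have hiK : i ≤ K := (Nat.lt_succ_iff.mp (mem_range.mp hi)).trans hm.le
    calc w i * δ i ≤ w i * M := mul_le_mul_of_nonneg_left (hMi i hiK) (hw i hiK)
      _ = M * w i := mul_comm _ _
  -- backward summation: δ_j ≤ C·M·Σ_{m∈[j,K)} Σ_{i≤m} w_i
  have hback : ∀ d j, j + d = K → δ j ≤ C * M * ∑ m ∈ Ico j K, ∑ i ∈ range (m + 1), w i := by
    intro d
    induction d with
    | zero => intro j hj; rw [add_zero] at hj; subst hj; simp [hK]
    | succ d ih =>
      intro j hj
      have hjK : j < K := by omega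
      have ih' := ih (j + 1) (by omega)
      have hstep := hrec j hjK
      have hf := hfb j hjK
      rw [Finset.sum_eq_sum_Ico_succ_bot hjK, mul_add]
      linarith [hstep, hf, ih']
  have hWnn : ∀ m, m < K → 0 ≤ ∑ i ∈ range (m + 1), w i := fun m hm =>
    Finset.sum_nonneg fun i hi => hw i ((Nat.lt_succ_iff.mp (mem_range.mp hi)).trans hm.le)
  have hCM : 0 ≤ C * M := mul_nonneg hC hM0
  have hMle : M ≤ C * M * ∑ i ∈ range K, ((K - i : ℕ) : ℝ) * w i := by
    have hb := hback (K - i₀) i₀ (by omega)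
    have hsub : ∑ m ∈ Ico i₀ K, ∑ i ∈ range (m + 1), w i ≤ ∑ m ∈ range K, ∑ i ∈ range (m + 1), w i :=
      Finset.sum_le_sum_of_subset_of_nonneg (fun m hm => mem_range.mpr (mem_Ico.mp hm).2)
        fun m hm _ => hWnn m (mem_range.mp hm)
    rw [← sum_exchange_depth w K]
    exact hb.trans (mul_le_mul_of_nonneg_left hsub hCM)
  have hM0' : M = 0 := by
    by_contra hne'
    have hMpos : 0 < M := lt_of_le_of_ne hM0 (Ne.symm hne')
    have : C * M * ∑ i ∈ range K, ((K - i : ℕ) : ℝ) * w i < M := by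
      calc C * M * ∑ i ∈ range K, ((K - i : ℕ) : ℝ) * w i = M * (C * ∑ i ∈ range K, ((K - i : ℕ) : ℝ) * w i) := by ring
        _ < M * 1 := mul_lt_mul_of_pos_left hsmall hMpos
        _ = M := mul_one M
    linarith
  intro j hj
  exact le_antisymm (by rw [← hM0']; exact hMi j hj) (hδ j)

/-- The square-root telescoping one order up from node U2's `inv_cube_le_telescope`: for 0 < p ≤ q with q² − p² = b > 0,
`1∕q ≤ (2∕b)(q − p)` (the discrete form of ∫ (a + bt)^{−1∕2} dt = (2∕b)√(a + bt)). [folklore] -/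
theorem inv_sprof_le_telescope {p q b : ℝ} (hp : 0 < p) (hpq : p ≤ q) (hb : 0 < b) (h : q ^ 2 - p ^ 2 = b) :
    1 / q ≤ 2 / b * (q - p) := by
  have hq : 0 < q := lt_of_lt_of_le hp hpq
  have hqp : q - p = b / (q + p) := by
    rw [eq_div_iff (by positivity)]; nlinarith [h]
  rw [hqp, show 2 / b * (b / (q + p)) = 2 / (q + p) by field_simp, div_le_div_iff₀ hq (by positivity)]
  nlinarith

/-- **The profile sum one order up**: with a_m = 1∕γ² + b·m (node U2's `prof`), Σ_{m≤K} a_m^{−1∕2} ≤ γ + (2∕b)·√a_K — split off m = 0 (= γ)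
and telescope the rest (Σ_{m<K} a_{m+1}^{−1∕2} ≤ (2∕b)(√a_K − √a_0)).  NOT K-uniform: it grows like √K. [folklore] -/
theorem sum_invSprof_le {γ b : ℝ} (hγ : 0 < γ) (hb : 0 < b) (K : ℕ) :
    ∑ m ∈ range (K + 1), 1 / sprof γ b m ≤ γ + 2 / b * sprof γ b K := by
  have hp0 := sprof_pos hγ hb.le
  rw [Finset.sum_range_succ' (fun m => 1 / sprof γ b m) K, sprof_zero hγ, one_div_one_div]
  have h1 : ∑ m ∈ range K, 1 / sprof γ b (m + 1) ≤ ∑ m ∈ range K, 2 / b * (sprof γ b (m + 1) - sprof γ b m) :=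
    Finset.sum_le_sum fun m _ => inv_sprof_le_telescope (hp0 m) (sprof_mono hb.le m) hb (sprof_sq_diff hγ hb.le m)
  have h2 : ∑ m ∈ range K, 2 / b * (sprof γ b (m + 1) - sprof γ b m) = 2 / b * (sprof γ b K - sprof γ b 0) := by
    rw [← Finset.mul_sum, Finset.sum_range_sub (fun m => sprof γ b m) K]
  have h3 : 2 / b * (sprof γ b K - sprof γ b 0) ≤ 2 / b * sprof γ b K := by
    have := hp0 0
    have h2b : 0 < 2 / b := div_pos (by norm_num) hb
    nlinarith
  linarith

/-- **THE DEPTH-WEIGHTED AF SUM ALONG TWO RUNS OF THE SAME LENGTH.**  Two runs g, g′ of (0.20) with the same β, K steps, couplings in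
]0, γ], AF letter `b ≤ β_{k+1}` on the boxes (b > 0): `Σ_{i≤K} (K − i)·g_i² g′_i ≤ (γ + (2∕b)√(1∕γ² + bK))∕b` — each run obeys
1∕g_i² ≥ 1∕γ² + b(K − i) (`inv_sq_lower_of_betaLower`), so (K − i)·g_i² ≤ 1∕b and g′_i ≤ a_{K−i}^{−1∕2}, and `sum_invSprof_le` bounds the
reflected profile sum.  Grows like √K (contrast PART 1's K-uniform `sum_weights_le`). [cite: Balaban1987RG1, (0.31) p.259] -/
theorem sum_depthWeights_le {γ b : ℝ} {K : ℕ} {g g' : ℕ → ℝ} (hγ : 0 < γ) (hb : 0 < b)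
    (hg : RGEqH K S.β g) (hg' : RGEqH K S.β g')
    (hbox : ∀ i, i ≤ K → 0 < g i ∧ g i ≤ γ) (hbox' : ∀ i, i ≤ K → 0 < g' i ∧ g' i ≤ γ) (hlo : BetaLowerH b γ S.β) :
    ∑ i ∈ range (K + 1), ((K - i : ℕ) : ℝ) * ((g i) ^ 2 * g' i) ≤ (γ + 2 / b * sprof γ b K) / b := by
  have hp0 := sprof_pos hγ hb.le
  have hpt : ∀ i, i ≤ K → ((K - i : ℕ) : ℝ) * ((g i) ^ 2 * g' i) ≤ 1 / b * (1 / sprof γ b (K - i)) := by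
    intro i hi
    have hgi := hbox i hi
    have hgi' := hbox' i hi
    have hgK := hbox K le_rfl
    have hgK' := hbox' K le_rfl
    have hAK : 1 / γ ^ 2 ≤ 1 / (g K) ^ 2 :=
      one_div_le_one_div_of_le (pow_pos hgK.1 2) (pow_le_pow_left₀ hgK.1.le hgK.2 2)
    have hBK : 1 / γ ^ 2 ≤ 1 / (g' K) ^ 2 :=
      one_div_le_one_div_of_le (pow_pos hgK'.1 2) (pow_le_pow_left₀ hgK'.1.le hgK'.2 2)
    have h1 := inv_sq_lower_of_betaLower hg hbox hlo hi
    have h2 := inv_sq_lower_of_betaLower hg' hbox' hlo hi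
    have ha : prof γ b (K - i) ≤ 1 / (g i) ^ 2 := by unfold T4CouplingMatching.prof; linarith
    have ha' : prof γ b (K - i) ≤ 1 / (g' i) ^ 2 := by unfold T4CouplingMatching.prof; linarith
    -- (K − i)·g_i² ≤ 1∕b
    have hm : ((K - i : ℕ) : ℝ) * (g i) ^ 2 ≤ 1 / b := by
      have hm0 : 0 ≤ ((K - i : ℕ) : ℝ) := Nat.cast_nonneg _
      have hbm : b * ((K - i : ℕ) : ℝ) ≤ 1 / (g i) ^ 2 := by
        have : 0 ≤ 1 / (g K) ^ 2 := by positivity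
        linarith
      rw [le_div_iff₀ hb]
      have hgsq : 0 < (g i) ^ 2 := pow_pos hgi.1 2
      have := mul_le_mul_of_nonneg_right hbm hgsq.le
      rw [one_div_mul_cancel hgsq.ne'] at this
      nlinarith
    -- g′_i ≤ a_{K−i}^{−1∕2}
    have hsq' : (g' i) ^ 2 ≤ (1 / sprof γ b (K - i)) ^ 2 := by
      rw [one_div_pow, sprof_sq hγ hb.le, le_one_div (pow_pos hgi'.1 2) (prof_pos hγ hb.le _)]; exact ha'
    have h' : g' i ≤ 1 / sprof γ b (K - i) :=
      (pow_le_pow_iff_left₀ hgi'.1.le (one_div_pos.mpr (hp0 _)).le two_ne_zero).mp hsq'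
    calc ((K - i : ℕ) : ℝ) * ((g i) ^ 2 * g' i) = (((K - i : ℕ) : ℝ) * (g i) ^ 2) * g' i := by ring
      _ ≤ 1 / b * (1 / sprof γ b (K - i)) := mul_le_mul hm h' hgi'.1.le (by positivity)
  calc ∑ i ∈ range (K + 1), ((K - i : ℕ) : ℝ) * ((g i) ^ 2 * g' i)
      ≤ ∑ i ∈ range (K + 1), 1 / b * (1 / sprof γ b (K - i)) :=
        Finset.sum_le_sum fun i hi => hpt i (Nat.lt_succ_iff.mp (mem_range.mp hi))
    _ = 1 / b * ∑ i ∈ range (K + 1), 1 / sprof γ b (K + 1 - 1 - i) := by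
        rw [Finset.mul_sum]
        refine Finset.sum_congr rfl fun i _ => ?_
        rw [show K + 1 - 1 - i = K - i by omega]
    _ = 1 / b * ∑ m ∈ range (K + 1), 1 / sprof γ b m := by
        rw [Finset.sum_range_reflect (fun m => 1 / sprof γ b m) (K + 1)]
    _ ≤ 1 / b * (γ + 2 / b * sprof γ b K) := mul_le_mul_of_nonneg_left (sum_invSprof_le hγ hb K) (by positivity)
    _ = (γ + 2 / b * sprof γ b K) / b := by ring

/-- **The linear depth bound** (cruder, from PART 1's K-uniform weight sum): Σ_{i≤K} (K − i)·g_i² g′_i ≤ K·(γ³ + 2γ∕b) (each K − i ≤ K and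
`sum_weights_le`). [cite: Balaban1987RG1, (0.31) p.259] -/
theorem sum_depthWeights_le_linear {γ b : ℝ} {K : ℕ} {g g' : ℕ → ℝ} (hγ : 0 < γ) (hb : 0 < b)
    (hg : RGEqH K S.β g) (hg' : RGEqH K S.β g')
    (hbox : ∀ i, i ≤ K → 0 < g i ∧ g i ≤ γ) (hbox' : ∀ i, i ≤ K → 0 < g' i ∧ g' i ≤ γ) (hlo : BetaLowerH b γ S.β) :
    ∑ i ∈ range (K + 1), ((K - i : ℕ) : ℝ) * ((g i) ^ 2 * g' i) ≤ (K : ℝ) * (γ ^ 3 + 2 * γ / b) := by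
  have hu : ∀ i, i ≤ K → 0 ≤ (g i) ^ 2 * g' i := fun i hi => mul_nonneg (sq_nonneg _) (hbox' i hi).1.le
  calc ∑ i ∈ range (K + 1), ((K - i : ℕ) : ℝ) * ((g i) ^ 2 * g' i)
      ≤ ∑ i ∈ range (K + 1), (K : ℝ) * ((g i) ^ 2 * g' i) := by
        refine Finset.sum_le_sum fun i hi => mul_le_mul_of_nonneg_right ?_ (hu i (Nat.lt_succ_iff.mp (mem_range.mp hi)))
        exact_mod_cast Nat.sub_le K i
    _ = (K : ℝ) * ∑ i ∈ range (K + 1), (g i) ^ 2 * g' i := by rw [Finset.mul_sum]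
    _ ≤ (K : ℝ) * (γ ^ 3 + 2 * γ / b) := mul_le_mul_of_nonneg_left (sum_weights_le hγ hb hg hg' hbox hbox' hlo) (Nat.cast_nonneg K)

/-! ## §16 Uniqueness up to a depth under a uniform history modulus -/

/-- **UNIQUENESS UP TO DEPTH ≍ b³∕C² UNDER A UNIFORM MODULUS (θ = 1).**  Two runs of (0.20) of the SAME length K with the same β, couplings
in ]0, γ], PINNED g_K = g′_K; history moduli `HistLipschitz Λ γ S.β` with `FadingMemory C 1 Λ` — i.e. 0 ≤ Λ k i ≤ C for all i ≤ k, ONE constant,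
NO decay in the age (the tree's uniform coordinatewise clause); the AF letter `BetaLowerH b` (b > 0); and the DEPTH CONDITION
`C·(γ + (2∕b)√(1∕γ² + bK)) < b`.  THEN the runs coincide at every scale.  For large K the condition reads 2C√K ≲ b^{3∕2}, i.e. K ≲ b³∕(4C²):
«g₀(ε, g)» is a function UP TO THAT DEPTH — and, by the companion `…HistoryNonunique*`, in general NOT beyond a depth of the same order.
Contrast PART 1's `runs_eq_of_fadingMemory` (θ < 1: EVERY K). [cite: Balaban1987RG1, Thm 2 p.259 («g₀ = g₀(ε, g)») with (0.20) p.256 and p.298] -/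
theorem runs_eq_of_uniformModulus {γ C b : ℝ} {Λ : ℕ → ℕ → ℝ} {K : ℕ} {g g' : ℕ → ℝ}
    (hC : 0 ≤ C) (hγ : 0 < γ) (hb : 0 < b)
    (hg : RGEqH K S.β g) (hg' : RGEqH K S.β g')
    (hbox : ∀ i, i ≤ K → 0 < g i ∧ g i ≤ γ) (hbox' : ∀ i, i ≤ K → 0 < g' i ∧ g' i ≤ γ) (hpin : g K = g' K)
    (hL : HistLipschitz Λ γ S.β) (hΛ : FadingMemory C 1 Λ) (hlo : BetaLowerH b γ S.β)
    (hdepth : C * (γ + 2 / b * Real.sqrt (1 / γ ^ 2 + b * K)) < b) :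
    ∀ j, j ≤ K → g j = g' j := by
  set δ : ℕ → ℝ := fun j => |1 / (g j) ^ 2 - 1 / (g' j) ^ 2| with hδ
  have hu : ∀ i, i ≤ K → 0 ≤ (g i) ^ 2 * g' i := fun i hi => mul_nonneg (sq_nonneg _) (hbox' i hi).1.le
  have hK : δ K = 0 := by simp [hδ, hpin]
  have hrec : ∀ j, j < K → δ j ≤ δ (j + 1) + C * ∑ i ∈ range (j + 1), ((g i) ^ 2 * g' i) * δ i := by
    intro j hj
    have hstep := hist_step hg hg' hbox hbox' hL (fun k i hik => (hΛ k i hik).1) hj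
    have hsum : ∑ i ∈ range (j + 1), Λ j i * ((g i) ^ 2 * g' i) * δ i ≤ C * ∑ i ∈ range (j + 1), ((g i) ^ 2 * g' i) * δ i := by
      rw [Finset.mul_sum]
      refine Finset.sum_le_sum fun i hi => ?_
      have hij : i ≤ j := Nat.lt_succ_iff.mp (mem_range.mp hi)
      have hiK : i ≤ K := by omega
      have hnn : 0 ≤ (g i) ^ 2 * g' i * δ i := mul_nonneg (hu i hiK) (abs_nonneg _)
      have hΛC : Λ j i ≤ C := by have := (hΛ j i hij).2; simpa using this
      calc Λ j i * ((g i) ^ 2 * g' i) * δ i = Λ j i * ((g i) ^ 2 * g' i * δ i) := by ring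
        _ ≤ C * ((g i) ^ 2 * g' i * δ i) := mul_le_mul_of_nonneg_right hΛC hnn
    simp only [hδ] at hstep hsum ⊢
    linarith [hstep, hsum]
  -- the depth condition gives C·W < 1
  have hW := sum_depthWeights_le hγ hb hg hg' hbox hbox' hlo
  have hsmall : C * ∑ i ∈ range K, ((K - i : ℕ) : ℝ) * ((g i) ^ 2 * g' i) < 1 := by
    have hsub : ∑ i ∈ range K, ((K - i : ℕ) : ℝ) * ((g i) ^ 2 * g' i)
        ≤ ∑ i ∈ range (K + 1), ((K - i : ℕ) : ℝ) * ((g i) ^ 2 * g' i) :=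
      Finset.sum_le_sum_of_subset_of_nonneg (Finset.range_subset_range.mpr (Nat.le_succ K))
        (fun i hi _ => mul_nonneg (Nat.cast_nonneg _) (hu i (Nat.lt_succ_iff.mp (mem_range.mp hi))))
    have h1 : C * ∑ i ∈ range K, ((K - i : ℕ) : ℝ) * ((g i) ^ 2 * g' i) ≤ C * ((γ + 2 / b * sprof γ b K) / b) :=
      mul_le_mul_of_nonneg_left (hsub.trans hW) hC
    have h2 : C * ((γ + 2 / b * sprof γ b K) / b) < 1 := by
      rw [← mul_div_assoc, div_lt_one hb]
      exact hdepth
    exact lt_of_le_of_lt h1 h2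
  have hzero := feedback_kernel_zero (δ := δ) (w := fun i => (g i) ^ 2 * g' i) hC (fun j => abs_nonneg _) hu hK hrec hsmall
  intro j hj
  have hδ0 : δ j = 0 := hzero j hj
  have heq : 1 / (g j) ^ 2 = 1 / (g' j) ^ 2 := by
    have : |1 / (g j) ^ 2 - 1 / (g' j) ^ 2| = 0 := hδ0
    exact sub_eq_zero.mp (abs_eq_zero.mp this)
  have hsq : (g j) ^ 2 = (g' j) ^ 2 := by
    have := congrArg (fun x : ℝ => 1 / x) heq
    simpa only [one_div_one_div] using this
  exact (pow_left_inj₀ (hbox j hj).1.le (hbox' j hj).1.le two_ne_zero).mp hsq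

/-- **The linear-depth form**: the same with the depth condition `C·K·(γ³ + 2γ∕b) < 1` (from `sum_depthWeights_le_linear`; weaker for
large K, but free of square roots). [cite: Balaban1987RG1, Thm 2 p.259 («g₀ = g₀(ε, g)») with (0.20) p.256 and p.298] -/
theorem runs_eq_of_uniformModulus_linear {γ C b : ℝ} {Λ : ℕ → ℕ → ℝ} {K : ℕ} {g g' : ℕ → ℝ}
    (hC : 0 ≤ C) (hγ : 0 < γ) (hb : 0 < b)
    (hg : RGEqH K S.β g) (hg' : RGEqH K S.β g')
    (hbox : ∀ i, i ≤ K → 0 < g i ∧ g i ≤ γ) (hbox' : ∀ i, i ≤ K → 0 < g' i ∧ g' i ≤ γ) (hpin : g K = g' K)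
    (hL : HistLipschitz Λ γ S.β) (hΛ : FadingMemory C 1 Λ) (hlo : BetaLowerH b γ S.β)
    (hdepth : C * ((K : ℝ) * (γ ^ 3 + 2 * γ / b)) < 1) :
    ∀ j, j ≤ K → g j = g' j := by
  set δ : ℕ → ℝ := fun j => |1 / (g j) ^ 2 - 1 / (g' j) ^ 2| with hδ
  have hu : ∀ i, i ≤ K → 0 ≤ (g i) ^ 2 * g' i := fun i hi => mul_nonneg (sq_nonneg _) (hbox' i hi).1.le
  have hK : δ K = 0 := by simp [hδ, hpin]
  have hrec : ∀ j, j < K → δ j ≤ δ (j + 1) + C * ∑ i ∈ range (j + 1), ((g i) ^ 2 * g' i) * δ i := by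
    intro j hj
    have hstep := hist_step hg hg' hbox hbox' hL (fun k i hik => (hΛ k i hik).1) hj
    have hsum : ∑ i ∈ range (j + 1), Λ j i * ((g i) ^ 2 * g' i) * δ i ≤ C * ∑ i ∈ range (j + 1), ((g i) ^ 2 * g' i) * δ i := by
      rw [Finset.mul_sum]
      refine Finset.sum_le_sum fun i hi => ?_
      have hij : i ≤ j := Nat.lt_succ_iff.mp (mem_range.mp hi)
      have hiK : i ≤ K := by omega
      have hnn : 0 ≤ (g i) ^ 2 * g' i * δ i := mul_nonneg (hu i hiK) (abs_nonneg _)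
      have hΛC : Λ j i ≤ C := by have := (hΛ j i hij).2; simpa using this
      calc Λ j i * ((g i) ^ 2 * g' i) * δ i = Λ j i * ((g i) ^ 2 * g' i * δ i) := by ring
        _ ≤ C * ((g i) ^ 2 * g' i * δ i) := mul_le_mul_of_nonneg_right hΛC hnn
    simp only [hδ] at hstep hsum ⊢
    linarith [hstep, hsum]
  have hW := sum_depthWeights_le_linear hγ hb hg hg' hbox hbox' hlo
  have hsmall : C * ∑ i ∈ range K, ((K - i : ℕ) : ℝ) * ((g i) ^ 2 * g' i) < 1 := by
    have hsub : ∑ i ∈ range K, ((K - i : ℕ) : ℝ) * ((g i) ^ 2 * g' i)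
        ≤ ∑ i ∈ range (K + 1), ((K - i : ℕ) : ℝ) * ((g i) ^ 2 * g' i) :=
      Finset.sum_le_sum_of_subset_of_nonneg (Finset.range_subset_range.mpr (Nat.le_succ K))
        (fun i hi _ => mul_nonneg (Nat.cast_nonneg _) (hu i (Nat.lt_succ_iff.mp (mem_range.mp hi))))
    exact lt_of_le_of_lt (mul_le_mul_of_nonneg_left (hsub.trans hW) hC) hdepth
  have hzero := feedback_kernel_zero (δ := δ) (w := fun i => (g i) ^ 2 * g' i) hC (fun j => abs_nonneg _) hu hK hrec hsmall
  intro j hj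
  have hδ0 : δ j = 0 := hzero j hj
  have heq : 1 / (g j) ^ 2 = 1 / (g' j) ^ 2 := by
    have : |1 / (g j) ^ 2 - 1 / (g' j) ^ 2| = 0 := hδ0
    exact sub_eq_zero.mp (abs_eq_zero.mp this)
  have hsq : (g j) ^ 2 = (g' j) ^ 2 := by
    have := congrArg (fun x : ℝ => 1 / x) heq
    simpa only [one_div_one_div] using this
  exact (pow_left_inj₀ (hbox j hj).1.le (hbox' j hj).1.le two_ne_zero).mp hsq

/-- **ON THE CARRIER, UP TO THE DEPTH**: for a setting with the printed `Definitions` ((0.18): runs start at their bare coupling), two runs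
(K, m, g₀), (K, m, g₀′) obeying (0.20), staying in ]0, γ] and ending at the same renormalized coupling have the same bare coupling, provided
`HistLipschitz Λ γ S.β` with the UNIFORM bound `FadingMemory C 1 Λ`, the AF letter `BetaLowerH b γ S.β` and the depth condition
`C·(γ + (2∕b)√(1∕γ² + bK)) < b`. [cite: Balaban1987RG1, Thm 2 p.259 («g₀ = g₀(ε, g)») with (0.18)–(0.20) pp.255–256 and p.298] -/
theorem bareCoupling_unique_upToDepth (hD : Definitions S) {γ C b : ℝ} {Λ : ℕ → ℕ → ℝ}
    (hC : 0 ≤ C) (hγ : 0 < γ) (hb : 0 < b)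
    (hL : HistLipschitz Λ γ S.β) (hΛ : FadingMemory C 1 Λ) (hlo : BetaLowerH b γ S.β) {K m : ℕ}
    (hdepth : C * (γ + 2 / b * Real.sqrt (1 / γ ^ 2 + b * K)) < b) {g₀ g₀' : ℝ}
    (hrg : RGEqH K S.β (S.cpl ⟨K, m, g₀⟩)) (hrg' : RGEqH K S.β (S.cpl ⟨K, m, g₀'⟩))
    (hI : Step.InInterval γ K (S.cpl ⟨K, m, g₀⟩)) (hI' : Step.InInterval γ K (S.cpl ⟨K, m, g₀'⟩))
    (hpin : S.cpl ⟨K, m, g₀⟩ K = S.cpl ⟨K, m, g₀'⟩ K) :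
    g₀ = g₀' ∧ ∀ j, j ≤ K → S.cpl ⟨K, m, g₀⟩ j = S.cpl ⟨K, m, g₀'⟩ j := by
  have hall := runs_eq_of_uniformModulus hC hγ hb hrg hrg' hI hI' hpin hL hΛ hlo hdepth
  refine ⟨?_, hall⟩
  have h0 := hall 0 (Nat.zero_le K)
  rwa [hD.d018, hD.d018] at h0

/-- **END — THEOREM 2's «g₀ = g₀(ε, g)» EXISTS AND IS UNIQUE UP TO DEPTH ≍ b³∕C² UNDER A UNIFORM HISTORY MODULUS.**  `Theorem2Statement S hL`
([I] Theorem 2 AS PRINTED, a HYPOTHESIS), the printed `Definitions`, the box-wide upper letter `β_{k+1} ≤ b′` on ]0, γ_u]^{k+1} (whence (0.20)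
holds INSIDE the interval along in-interval runs — `…TunedUpper.hrg_of_betaUpperH`), the AF letter `b ≤ β_{k+1}` (b > 0), history moduli
`HistLipschitz Λ γ_u S.β` with the UNIFORM bound `FadingMemory C 1 Λ` (NO fading), and a box size γ₁ ≤ γ_u with b′γ₁² < 1 ⟹ for every m there
is γ₂ > 0 such that for every γ ≤ γ₂ there is g₁ > 0 such that for every g ∈ ]0, g₁] and every depth K WITH `C·(γ₁ + (2∕b)√(1∕γ₁² + bK)) < b`
there is EXACTLY ONE bare coupling g₀ whose run (K, m, g₀) stays in ]0, γ] and ends at g_K = g.  Existence is Theorem 2's; uniqueness is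
§16.  The depth restriction is NOT an artefact (companion `…HistoryNonunique*`); PART 1 removes it under θ < 1.  A REDUCTION over UNPRINTED
letters; nothing of [I] asserted. [cite: Balaban1987RG1, Thm 2 (0.31) p.259 with (0.20) p.256 and p.298] -/
theorem theorem2_existsUnique_upToDepth {hL : Odd S.L ∧ 1 < S.L} (h : Theorem2Statement S hL) (hD : Definitions S)
    {γu γ₁ b b' C : ℝ} {Λ : ℕ → ℕ → ℝ} (hup : BetaUpperH b' γu S.β) (hlo : BetaLowerH b γu S.β) (hb : 0 < b)
    (hL' : HistLipschitz Λ γu S.β) (hΛ : FadingMemory C 1 Λ) (hC : 0 ≤ C)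
    (hγ₁ : 0 < γ₁) (hγ₁u : γ₁ ≤ γu) (hbu : b' * γ₁ ^ 2 < 1) (m : ℕ) :
    ∃ γ₂ : ℝ, 0 < γ₂ ∧ ∀ γ : ℝ, 0 < γ → γ ≤ γ₂ → ∃ g₁ : ℝ, 0 < g₁ ∧ ∀ g : ℝ, 0 < g → g ≤ g₁ → ∀ K : ℕ,
      C * (γ₁ + 2 / b * Real.sqrt (1 / γ₁ ^ 2 + b * K)) < b →
      ∃! g₀ : ℝ, Step.InInterval γ K (S.cpl ⟨K, m, g₀⟩) ∧ S.cpl ⟨K, m, g₀⟩ K = g := by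
  obtain ⟨γ₀, hγ₀, hγ⟩ := tunedRuns_of_theorem2Statement h m
  refine ⟨min γ₀ γ₁, lt_min hγ₀ hγ₁, fun γ hγpos hγle => ?_⟩
  have hγ₀le : γ ≤ γ₀ := hγle.trans (min_le_left _ _)
  have hγ₁le : γ ≤ γ₁ := hγle.trans (min_le_right _ _)
  have hγule : γ ≤ γu := hγ₁le.trans hγ₁u
  obtain ⟨g₁, hg₁, hg⟩ := hγ γ hγpos hγ₀le
  refine ⟨g₁, hg₁, fun g hgpos hgle K hdepth₁ => ?_⟩
  obtain ⟨β, β', -, -, hK⟩ := hg g hgpos hgle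
  obtain ⟨g₀, hI, hend, -⟩ := hK K
  -- the letters on the boxes ]0, γ] (for (0.20) inside the interval) and ]0, γ₁] (for the uniqueness theorem: the depth condition is
  -- stated at γ₁, and a run in ]0, γ] is a run in ]0, γ₁])
  have hup' : BetaUpperH b' γ S.β := fun k v hv => hup k v (box_mono hγule k hv)
  have hlo₁ : BetaLowerH b γ₁ S.β := fun k v hv => hlo k v (box_mono hγ₁u k hv)
  have hL₁ : HistLipschitz Λ γ₁ S.β := fun k p q hp hq => hL' k p q (box_mono hγ₁u k hp) (box_mono hγ₁u k hq)
  have hγsq : γ ^ 2 ≤ γ₁ ^ 2 := pow_le_pow_left₀ hγpos.le hγ₁le 2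
  have hbγ : b' * γ ^ 2 < 1 := by
    rcases le_or_gt 0 b' with hb' | hb'
    · exact lt_of_le_of_lt (mul_le_mul_of_nonneg_left hγsq hb') hbu
    · nlinarith [sq_nonneg γ]
  refine ⟨g₀, ⟨hI, hend⟩, fun y hy => ?_⟩
  obtain ⟨hIy, hendy⟩ := hy
  have hI₁ : ∀ i, i ≤ K → 0 < S.cpl ⟨K, m, g₀⟩ i ∧ S.cpl ⟨K, m, g₀⟩ i ≤ γ₁ := fun i hi =>
    ⟨(hI i hi).1, (hI i hi).2.trans hγ₁le⟩
  have hIy₁ : ∀ i, i ≤ K → 0 < S.cpl ⟨K, m, y⟩ i ∧ S.cpl ⟨K, m, y⟩ i ≤ γ₁ := fun i hi =>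
    ⟨(hIy i hi).1, (hIy i hi).2.trans hγ₁le⟩
  have hall := runs_eq_of_uniformModulus hC hγ₁ hb
    (hrg_of_betaUpperH hD hγpos hup' hbγ ⟨K, m, y⟩ hIy) (hrg_of_betaUpperH hD hγpos hup' hbγ ⟨K, m, g₀⟩ hI)
    hIy₁ hI₁ (hendy.trans hend.symm) hL₁ hΛ hlo₁ hdepth₁
  have h0 := hall 0 (Nat.zero_le K)
  rwa [hD.d018, hD.d018] at h0

end

end Summit.QuantumFields.BalabanUV.Beta.EriceFlowEnclosureB12AsPrintedHistoryUniformDepth
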